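import Literature.AlgebraicGeometry.Resolution.LocalUniformizationClosedPoints
import Literature.AlgebraicGeometry.Resolution.FieldsJ2
import Literature.AlgebraicGeometry.Resolution.ExcellentRings
import Literature.AlgebraicGeometry.Resolution.LocalBlowup
import Summits.ResolutionOfSingularities.ResolutionOfSingularities.Theorems.ValuativeLuAlphaPTorsorTowerTools
import Summits.ResolutionOfSingularities.ResolutionOfSingularities.Theorems.ValuativeLuAlphaPTorsorZeroDimReduction
import Summits.ResolutionOfSingularities.ResolutionOfSingularities.Theorems.ValuativeLuAlphaPTorsorBirationalExit
import Summits.ResolutionOfSingularities.ResolutionOfSingularities.Theorems.ValuativeLuAlphaPTorsorValueExit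
import Mathlib.FieldTheory.Perfect
import HarnessLib

/-!
# `FrobeniusClosing.Steer`: torsor local uniformization over perfect fields reduces to
# zero-dimensional valuations

Crux `FrobeniusClosing.Steer` (item `stmt-ResolutionOfSingularities-16345`), line
`switching-dichotomy`, stub `stub_zeroDimPerfect`. Torsor local uniformization over a perfect
ground field `k` of characteristic `p` — given a valuation ring `O` of `K ⊇ k`, a finitely
generated `k`-subalgebra `A₀ ⊆ O` regular at the centre `𝔪_O ∩ A₀`, and `t ∈ K` with
`t ^ p ∈ A₀`, `Frac (A₀[t]) = K`, find a finitely generated `A ⊆ O` containing `A₀[t]` with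
`Frac A = K`, regular at the centre of `O` — holds at EVERY valuation ring of `K/k` as soon as
it holds at the ZERO-DIMENSIONAL ones (every `x ∈ O` is a root modulo `𝔪_O` of a non-zero
polynomial over `k`), the perfect ground field `k` being kept fixed.

Proof (Zariski–Samuel II, Ch. VI §17; folklore).
1. The regular locus of the finitely generated `k`-algebra `A₀` is open
   (`isOpen_regularLocus_of_finiteType_field`, Nagata–Grothendieck) and contains the centre
   `P = 𝔪_O ∩ A₀`; the basic opens form a basis, so `P ∈ D(g) ⊆ Reg(A₀)` for some `g ∈ A₀`.
2. `g ∉ P` means `v(g) = 1`, so `g⁻¹ ∈ O` and `A₁ := A₀[g⁻¹] ⊆ O` is finitely generated, with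
   `t ^ p ∈ A₁` and `Frac (A₁[t]) = K`.
3. `t ∈ O` (valuation rings are integrally closed), so `A₁[t] ⊆ O`; refine `O` to a valuation
   ring `O' ≤ O` minimal over `A₁[t]` (`exists_minimal_valuationSubring_le`), which is
   zero-dimensional over `k` (`exists_aeval_mem_nonunits_of_minimal`).
4. `A₁` is regular at the centre of `O'` (which may be bigger than the centre of `O`): inside `K`
   the local rings `(A₁)_{𝔪_{O'} ∩ A₁}` and `(A₀)_{𝔪_{O'} ∩ A₀}` coincide (`locAtCentre`; every
   element of `A₁` is `r / g ^ m` with `r ∈ A₀`, and `g` is a unit of `O'` since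
   `g⁻¹ ∈ A₁ ⊆ O'`), and the latter is regular because the centre `𝔪_{O'} ∩ A₀` lies in
   `D(g) ⊆ Reg(A₀)` (`isRegularLocalRing_locAtCentre_iff`).
5. The zero-dimensional statement at `(O', A₁, t)` yields `A`; regularity at the centre of `O'`
   descends to the coarsening `O` (`isRegularLocalRing_centre_of_le`, Serre's theorem).

Sources: O. Zariski, P. Samuel, *Commutative Algebra* II, Ch. VI §17 [ZariskiSamuel1960];
H. Matsumura, *Commutative Ring Theory*, §30, Cor. to Thm. 30.5 (fields are J-2) [Matsumura1987].
-/

set_option linter.dupNamespace false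

namespace Summit.ResolutionOfSingularities.ResolutionOfSingularities.Theorems.SwitchingDichotomy

open IsLocalRing Literature.AlgebraicGeometry.Resolution

section Helpers

variable {k K : Type} [Field k] [Field K] [Algebra k K]

/-- **Inverting a unit of the valuation ring does not change the local ring at the centre.**
If `g ∈ A₀` has `O.valuation g = 1`, then inside `K` the localisations at the centre of `O` of
`A₀[g⁻¹]` and of `A₀` coincide: every element of `A₀[g⁻¹]` is `r / g ^ m` with `r ∈ A₀`
(`exists_eq_div_pow_of_mem_adjoin_inv`), and `g` may be moved into the denominators.
[folklore] -/
theorem locAtCentre_adjoin_inv_eq (O : ValuationSubring K) (A₀ : Subalgebra k K) {g : K}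
    (hg : g ∈ A₀) (hg1 : O.valuation g = 1) :
    locAtCentre (Algebra.adjoin k (insert g⁻¹ (A₀ : Set K))).toSubring O =
      locAtCentre A₀.toSubring O := by
  have hg0 : g ≠ 0 := ne_zero_of_valuation_eq_one hg1
  refine le_antisymm ?_ (locAtCentre_mono O fun x hx => PfaffLine.le_adjoin_insert A₀ g⁻¹ hx)
  rintro x ⟨y, hy, z, hz, hvz, rfl⟩
  obtain ⟨r, m, hr, rfl⟩ := PfaffLine.exists_eq_div_pow_of_mem_adjoin_inv A₀ hg hg0 hy
  obtain ⟨r', m', hr', rfl⟩ := PfaffLine.exists_eq_div_pow_of_mem_adjoin_inv A₀ hg hg0 hz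
  have hvr' : O.valuation r' = 1 := by
    rw [map_div₀, map_pow, hg1, one_pow, div_one] at hvz
    exact hvz
  refine ⟨r * g ^ m', A₀.mul_mem hr (A₀.pow_mem hg _), r' * g ^ m,
    A₀.mul_mem hr' (A₀.pow_mem hg _), by rw [map_mul, map_pow, hvr', hg1, one_pow, one_mul], ?_⟩
  have hr'0 : r' ≠ 0 := ne_zero_of_valuation_eq_one hvr'
  field_simp

end Helpers

/-- **Torsor local uniformization over perfect fields: reduction to zero-dimensional valuation
rings** (stub `stub_zeroDimPerfect` of line `switching-dichotomy` of the crux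
`FrobeniusClosing.Steer`). For a prime `p`: if the torsor local uniformization statement over
perfect ground fields `k` of characteristic `p` holds at every valuation ring `O` that is
zero-dimensional over `k` (every `x ∈ O` is a root modulo `𝔪_O` of a non-zero polynomial over
`k`), then it holds at every valuation ring. Shrink the base to a regular basic open
neighbourhood `A₁ = A₀[g⁻¹]` of the centre (the regular locus of `A₀` is open,
`isOpen_regularLocus_of_finiteType_field`), refine `O` to a valuation ring `O' ≤ O` minimal over
`A₁[t]` (`exists_minimal_valuationSubring_le`; zero-dimensional by
`exists_aeval_mem_nonunits_of_minimal`); `A₁` is regular at the centre of `O'` because its local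
ring there equals that of `A₀` at a prime of `D(g)` (`locAtCentre_adjoin_inv_eq`,
`isRegularLocalRing_locAtCentre_iff`); apply the hypothesis at `O'` and descend regularity at the
centre to the coarsening `O` (`isRegularLocalRing_centre_of_le`).
[cite: ZariskiSamuel1960, Ch. VI §17] [folklore] -/
theorem stub_zeroDimPerfect :
    ∀ p : ℕ, p.Prime →
      (∀ (k K : Type) [Field k] [CharP k p] [PerfectField k] [Field K] [Algebra k K]
        (O : ValuationSubring K) (A₀ : Subalgebra k K) (h₀ : A₀.toSubring ≤ O.toSubring) (t : K),
        (∀ x ∈ O, ∃ f : Polynomial k, f ≠ 0 ∧ Polynomial.aeval x f ∈ O.nonunits) →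
        A₀.FG → t ^ p ∈ A₀ → IsFractionRing (Algebra.adjoin k (insert t (A₀ : Set K))) K →
        IsRegularLocalRing (Localization.AtPrime
          (Ideal.comap (Subring.inclusion h₀) (IsLocalRing.maximalIdeal O))) →
        ∃ (A : Subalgebra k K) (h : A.toSubring ≤ O.toSubring), A₀ ≤ A ∧ t ∈ A ∧ A.FG ∧
          IsFractionRing A K ∧ IsRegularLocalRing (Localization.AtPrime
            (Ideal.comap (Subring.inclusion h) (IsLocalRing.maximalIdeal O)))) →
      ∀ (k K : Type) [Field k] [CharP k p] [PerfectField k] [Field K] [Algebra k K]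
        (O : ValuationSubring K) (A₀ : Subalgebra k K) (h₀ : A₀.toSubring ≤ O.toSubring) (t : K),
        A₀.FG → t ^ p ∈ A₀ → IsFractionRing (Algebra.adjoin k (insert t (A₀ : Set K))) K →
        IsRegularLocalRing (Localization.AtPrime
          (Ideal.comap (Subring.inclusion h₀) (IsLocalRing.maximalIdeal O))) →
        ∃ (A : Subalgebra k K) (h : A.toSubring ≤ O.toSubring), A₀ ≤ A ∧ t ∈ A ∧ A.FG ∧
          IsFractionRing A K ∧ IsRegularLocalRing (Localization.AtPrime
            (Ideal.comap (Subring.inclusion h) (IsLocalRing.maximalIdeal O))) := by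
  intro p hp H k K _ _ _ _ _ O A₀ h₀ t hfg htp hfr hreg
  classical
  -- Step 1: a basic open neighbourhood `D(g) ∋ P` of the centre inside the regular locus
  set P : Ideal A₀.toSubring := Ideal.comap (Subring.inclusion h₀) (maximalIdeal O) with hPdef
  haveI hPprime : P.IsPrime := Ideal.comap_isPrime _ _
  letI : Algebra k A₀.toSubring := inferInstanceAs (Algebra k A₀)
  haveI : Algebra.FiniteType k A₀.toSubring := (A₀.fg_iff_finiteType).mp hfg
  have hopen : IsOpen (regularLocus A₀.toSubring) :=
    isOpen_regularLocus_of_finiteType_field k A₀.toSubring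
  have hmem : (⟨P, hPprime⟩ : PrimeSpectrum A₀.toSubring) ∈ regularLocus A₀.toSubring := hreg
  obtain ⟨_, ⟨g, rfl⟩, hgP, hgreg⟩ :=
    PrimeSpectrum.isTopologicalBasis_basic_opens.exists_subset_of_mem_open hmem hopen
  have hgP' : g ∉ P := hgP
  -- Step 2: `v(g) = 1`, and the finitely generated `A₁ := A₀[g⁻¹] ⊆ O`
  have hgA₀ : (g : K) ∈ A₀ := g.2
  have hg1 : O.valuation (g : K) = 1 := by
    refine le_antisymm ((O.valuation_le_one_iff _).mpr (h₀ g.2)) (not_lt.mp fun hlt => hgP' ?_)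
    exact (PfaffLine.mem_centre_iff O h₀ g).mpr hlt
  have hg0 : (g : K) ≠ 0 := ne_zero_of_valuation_eq_one hg1
  have hginvO : (g : K)⁻¹ ∈ O := inv_mem_of_valuation_eq_one O hg1
  set A₁ : Subalgebra k K := Algebra.adjoin k (insert (g : K)⁻¹ (A₀ : Set K)) with hA₁def
  have hA₀A₁ : A₀ ≤ A₁ := PfaffLine.le_adjoin_insert A₀ _
  have hginvA₁ : (g : K)⁻¹ ∈ A₁ := PfaffLine.mem_adjoin_insert A₀ _
  have h₁ : A₁.toSubring ≤ O.toSubring :=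
    PfaffLine.adjoin_insert_toSubring_le O.toSubring A₀ h₀ hginvO
  have hfg₁ : A₁.FG := PfaffLine.fg_adjoin_insert hfg _
  have htp₁ : t ^ p ∈ A₁ := hA₀A₁ htp
  have hfr₁ : IsFractionRing (Algebra.adjoin k (insert t (A₁ : Set K))) K := by
    haveI := hfr
    exact isFractionRing_subalgebra_of_le _ _
      (Algebra.adjoin_mono (Set.insert_subset_insert hA₀A₁))
  -- Step 3: `t ∈ O`; a valuation ring `O' ≤ O` minimal over `A₁[t]`, zero-dimensional over `k`
  have htO : t ∈ O := PfaffLine.mem_valuationSubring_of_pow_mem O hp.ne_zero (h₀ htp)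
  have hA₁tO : (Algebra.adjoin k (insert t (A₁ : Set K))).toSubring ≤ O.toSubring :=
    PfaffLine.adjoin_insert_toSubring_le O.toSubring A₁ h₁ htO
  obtain ⟨O', hO'O, hA₁tO', hmin⟩ :=
    exists_minimal_valuationSubring_le (Algebra.adjoin k (insert t (A₁ : Set K))) O hA₁tO
  have hzd : ∀ x ∈ O', ∃ f : Polynomial k, f ≠ 0 ∧ Polynomial.aeval x f ∈ O'.nonunits :=
    exists_aeval_mem_nonunits_of_minimal _ (PfaffLine.fg_adjoin_insert hfg₁ t) O' hA₁tO' hmin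
  have h₁' : A₁.toSubring ≤ O'.toSubring := fun x hx =>
    hA₁tO' (PfaffLine.le_adjoin_insert A₁ t hx)
  have h₀' : A₀.toSubring ≤ O'.toSubring := fun x hx => h₁' (hA₀A₁ hx)
  -- Step 4: `A₁` is regular at the centre of `O'`
  have hg1' : O'.valuation (g : K) = 1 :=
    PfaffLine.valuation_eq_one_of_inv_mem O' hg0 (h₀' g.2) (h₁' hginvA₁)
  set Q₀ : Ideal A₀.toSubring := Ideal.comap (Subring.inclusion h₀') (maximalIdeal O')
    with hQ₀def
  haveI hQ₀prime : Q₀.IsPrime := Ideal.comap_isPrime _ _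
  have hgQ₀ : g ∉ Q₀ := fun h => by
    have h' := (PfaffLine.mem_centre_iff O' h₀' g).mp h
    rw [hg1'] at h'
    exact lt_irrefl _ h'
  have hQ₀reg : IsRegularLocalRing (Localization.AtPrime Q₀) :=
    hgreg (show (⟨Q₀, hQ₀prime⟩ : PrimeSpectrum A₀.toSubring) ∈
      (PrimeSpectrum.basicOpen g : Set (PrimeSpectrum A₀.toSubring)) from hgQ₀)
  have hloc₀ : IsRegularLocalRing (locAtCentre A₀.toSubring O') :=
    (isRegularLocalRing_locAtCentre_iff h₀').mpr hQ₀reg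
  have hloc₁ : IsRegularLocalRing (locAtCentre A₁.toSubring O') := by
    rw [hA₁def, locAtCentre_adjoin_inv_eq O' A₀ hgA₀ hg1']
    exact hloc₀
  have hreg₁' : IsRegularLocalRing (Localization.AtPrime
      (Ideal.comap (Subring.inclusion h₁') (maximalIdeal O'))) :=
    (isRegularLocalRing_locAtCentre_iff h₁').mp hloc₁
  -- Step 5: the zero-dimensional statement at `O'`, and descent to the coarsening `O`
  obtain ⟨A, hA, hA₁A, htA, hAfg, hfrA, hregA⟩ := H k K O' A₁ h₁' t hzd hfg₁ htp₁ hfr₁ hreg₁'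
  exact ⟨A, fun x hx => hO'O (hA hx), hA₀A₁.trans hA₁A, htA, hAfg, hfrA,
    isRegularLocalRing_centre_of_le A hO'O hA _ hregA⟩

end Summit.ResolutionOfSingularities.ResolutionOfSingularities.Theorems.SwitchingDichotomy
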